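import Summits.Ventures.YMGap.RobustBall.OneStateLoops
import Summits.Ventures.YMGap.RobustBall.MassGapOnBallZdGRowsSU3PV
import Summits.Ventures.YMGap.RobustBall.AreaLawRowsSU3PV
import HarnessLib

/-!
# Venture YMGap, track ROBUST-BALL (Y2) — `SU(3)` HYPOTHESIS-FREE ONE STATE for every finite-range LOOP ACTION in the Poincaré × Schwinger–Dyson
# star balls (`ℤ⁴`): the directive's own object (norm ball of Wilson-type loop actions) up to `β_W = 31/100`

HONEST FRAMING. WHAT THIS IS: a venture file (cell `pub-ymgap`, track Y2 ROBUST-BALL, seat engine-2 (g9); 0 compute).  ds-3's one-state composition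
`oneState_onBallZdG` and rb-p1's norm-ball inclusion `memBallZdG_loopFamilyAction` (a loop family `γ` with couplings `c` and UNWEIGHTED norm
`‖c‖₀ ≤ η` — `LoopNormLE 0 γ c η` — is a member of the gauge-invariant tier-1 ball `MemBallZdG (2η) (4η) R` in `d = 4`), applied to THIS SEAT's
hypothesis-free `SU(3)` PV cells: the `ℤ⁴` star cell `su3_massGapOnBallZdG_pvStar_<cell>` at `(β_W, 2ε, ε)` shrunk to `(2η, 4η)`, `η = ε/4`
(`MassGapOnBallZdG.mono`), × the PV pair-door area law `RobustBallPV.su3_areaLawOnBall_pv` at `(β_W, 8η, 4η)` shrunk to `(2η, 4η)` (`AreaLawOnBall.anti`).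
For each range `R` ONE `(C, c)`, `c > 0`: EVERY `SU(3)` loop action `S_W + Σ_i c_i Re tr U_{γ_i}/3` with finite carrier fibres, finitely many loops through
every link, loops of extent `≤ R` and `‖c‖₀ ≤ η` has ONE state (unique DLR state = periodised-torus limit), massive, plaquette decay, `HasAreaLawWith μ χ₃ C c`.
Class K outright.  (1 / 8, .0375) (1 / 6, .0285) (1 / 5, .0217) (1 / 4, .0123) (27 / 100, .0085) (3 / 10, .0032) (31 / 100, .0013) `(β_W, η)`: (1 / 8, .0375) (1 / 6, .0285) (1 / 5, .0217) (1 / 4, .0123) (27 / 100, .0085) (3 / 10, .0032) (31 / 100, .0013).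
WHAT MOVES: ds-3's hypothesis-free `SU(3)` loop cell was `(1/8, .037)` (`su3_loops_oneState_oneEighth`, eigen modulus); here `(1/8, .0375)` … `(31/100, .00125)` —
the hypothesis-free `SU(3)` loop-action one-state frontier moves `1/8 → 31/100`.  NOT CLAIMED: anything outside the UNWEIGHTED-norm radii (door artefacts), a
range-uniform `(C, c)`, existence of the string tension of a non-Wilson member; nothing at weak coupling, about the continuum limit or the Millennium problem.

References: ds-3's `RobustBall/OneStateLoops.lean`, `OneState.lean`; rb-p1's `LoopActionGaugeBall.lean` (`memBallZdG_loopFamilyAction`), `LoopActionMember.lean`;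
this seat's `MassGapOnBallZdGRowsSU3PV.lean`, `AreaLawRowsSU3PV.lean`, `Thresholds/OneLinkVarianceSD.lean`.
-/

noncomputable section

open MeasureTheory Filter Topology Function Finset
open scoped NNReal
open Literature.Probability.LatticeModels
open Literature.MathematicalPhysics.QuantumLattice hiding torusNorm
open Literature.MathematicalPhysics.QuantumFieldTheory hiding ZdEdge Site
open Literature.MathematicalPhysics.QuantumFieldTheory (walkEdges)
open Literature.Barriers.QuantumFields (IsMassiveState)
open Summit.Ventures.YMGap.RobustBallPV (su3_areaLawOnBall_pv)

namespace Summit.Ventures.YMGap.RobustBall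

variable {ι : Type*}

/-- **`SU(3)`, `ℤ⁴`, `β_W = 1 / 8`, loop norm `‖c‖₀ ≤ .0375`, HYPOTHESIS-FREE**: for each range `R` one `(C, c)`, `c > 0`, such that EVERY finite-range
`SU(3)` loop action (finite carrier fibres, finitely many loops through every link, loops of extent `≤ R`, `LoopNormLE 0 γ cpl (3 / 80)`) near Wilson
`β_W = 1 / 8` has ONE state: unique DLR state = periodised-torus limit, massive, plaquette decay, `HasAreaLawWith μ χ₃ C c`
(`su3_massGapOnBallZdG_pvStar_oneEighth` × the PV area law, loads shrunk to `(3 / 40, 3 / 20)`). [folklore] -/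
theorem su3_loops_oneState_pv_oneEighth (R : ℕ) :
    ∃ C c : ℝ, 0 < c ∧ ∀ (γ : ι → ZdLoop 4) (cpl : ι → ℝ),
      (∀ X, {i | walkEdges (γ i).walk = X}.Finite) → (∀ e : ZdEdge 4, {i | e ∈ walkEdges (γ i).walk}.Finite) →
      (∀ i, ∀ e ∈ walkEdges (γ i).walk, ∀ y ∈ walkEdges (γ i).walk, ‖e.1 - y.1‖ ≤ (R : ℝ)) →
      LoopNormLE 0 γ cpl (3 / 80) →
      ∀ (hdep : ∀ X, DependsOn (loopFamilyAction (d := 4) 3 γ cpl X) (↑X : Set (ZdEdge 4)))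
        (hg : ∀ X, IsZdGaugeInvariant (loopFamilyAction (d := 4) 3 γ cpl X))
        (hm : ∀ X, Measurable (loopFamilyAction (d := 4) 3 γ cpl X))
        (hb : ∀ X, ∃ C, ∀ U, |loopFamilyAction (d := 4) 3 γ cpl X U| ≤ C),
      ∃ μ : Measure (LGConfig 4 (SUN 3)),
        perturbedGibbsMeasures (d := 4) (fundamentalRep (Fin 3)) (((3 : ℕ) : ℝ) * ((1 / 8 : ℝ) / 9))
            (loopFamilyAction (d := 4) 3 γ cpl) (loopSupp γ) = {μ} ∧
        perturbedLimitPoints (((3 : ℕ) : ℝ) * ((1 / 8 : ℝ) / 9))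
            (periodisedFamily (loopFamilyAction (d := 4) 3 γ cpl) (loopSupp γ) hdep hg hm hb) = {μ} ∧
        IsMassiveState μ ∧ HasExponentialDecay (plaquetteCorrFn (fundamentalRep (Fin 3)) μ) ∧
        HasAreaLawWith μ (fun g => normalisedCharacter 3 (fundamentalRep (Fin 3) g)) C c := by
  have hgap : MassGapOnBallZdG 4 3 ((1 / 8 : ℝ) / 9) (3 / 40) (3 / 20) R := by
    have h := (su3_massGapOnBallZdG_pvStar_oneEighth R).mono (ε₀' := 3 / 40) (ε₁' := 3 / 20)
      (by norm_num) (by norm_num) le_rfl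
    norm_num at h ⊢; exact h
  have hA0 : AreaLawOnBall 3 4 ((1 / 8 : ℝ) / 3) (2 * (3 / 20)) (3 / 20) R (2 * R + 1) :=
    su3_areaLawOnBall_pv (n := 3) R (mv := 2 * R + 1) (by omega) (βW := 1 / 8) (ε := 3 / 20) (R := 1 / 12) (q := 1007783 / 1000000)
      (p := 774597 / 500000) (K := 175491 / 100000) (s₀ := 223607 / 250000) (by norm_num) (by norm_num) (by norm_num) (by norm_num) (by norm_num)
      (by norm_num) (by norm_num) (by norm_num) (by norm_num) (by norm_num) (by norm_num) (by norm_num) (by norm_num) (by norm_num)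
  have hA : AreaLawOnBall 3 4 (((3 : ℕ) : ℝ) * ((1 / 8 : ℝ) / 9)) (3 / 40) (3 / 20) R (2 * R + 1) := by
    have e : ((3 : ℕ) : ℝ) * ((1 / 8 : ℝ) / 9) = (1 / 8 : ℝ) / 3 := by push_cast; ring
    rw [e]
    exact hA0.anti (by norm_num) (by norm_num) le_rfl le_rfl
  have hgap' : MassGapOnBallZdG 4 3 ((1 / 8 : ℝ) / 9) (3 / 40) (3 / 20) R := hgap
  obtain ⟨C, c, hc, hA'⟩ := oneState_onBallZdG (N := 3) (β := (1 / 8 : ℝ) / 9) (by norm_num) (by norm_num) (by norm_num) hgap' hA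
  refine ⟨C, c, hc, fun γ cpl hfin hthr hR h hdep hg hm hb => hA' _ _ ?_ hdep hg hm hb⟩
  have hmem := memBallZdG_loopFamilyAction (d := 4) (N := 3) hfin hthr hR h
  norm_num at hmem ⊢
  exact hmem

/-- **`SU(3)`, `ℤ⁴`, `β_W = 1 / 6`, loop norm `‖c‖₀ ≤ .0285`, HYPOTHESIS-FREE**: for each range `R` one `(C, c)`, `c > 0`, such that EVERY finite-range
`SU(3)` loop action (finite carrier fibres, finitely many loops through every link, loops of extent `≤ R`, `LoopNormLE 0 γ cpl (57 / 2000)`) near Wilson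
`β_W = 1 / 6` has ONE state: unique DLR state = periodised-torus limit, massive, plaquette decay, `HasAreaLawWith μ χ₃ C c`
(`su3_massGapOnBallZdG_pvStar_oneSixth` × the PV area law, loads shrunk to `(57 / 1000, 57 / 500)`). [folklore] -/
theorem su3_loops_oneState_pv_oneSixth (R : ℕ) :
    ∃ C c : ℝ, 0 < c ∧ ∀ (γ : ι → ZdLoop 4) (cpl : ι → ℝ),
      (∀ X, {i | walkEdges (γ i).walk = X}.Finite) → (∀ e : ZdEdge 4, {i | e ∈ walkEdges (γ i).walk}.Finite) →
      (∀ i, ∀ e ∈ walkEdges (γ i).walk, ∀ y ∈ walkEdges (γ i).walk, ‖e.1 - y.1‖ ≤ (R : ℝ)) →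
      LoopNormLE 0 γ cpl (57 / 2000) →
      ∀ (hdep : ∀ X, DependsOn (loopFamilyAction (d := 4) 3 γ cpl X) (↑X : Set (ZdEdge 4)))
        (hg : ∀ X, IsZdGaugeInvariant (loopFamilyAction (d := 4) 3 γ cpl X))
        (hm : ∀ X, Measurable (loopFamilyAction (d := 4) 3 γ cpl X))
        (hb : ∀ X, ∃ C, ∀ U, |loopFamilyAction (d := 4) 3 γ cpl X U| ≤ C),
      ∃ μ : Measure (LGConfig 4 (SUN 3)),
        perturbedGibbsMeasures (d := 4) (fundamentalRep (Fin 3)) (((3 : ℕ) : ℝ) * ((1 / 6 : ℝ) / 9))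
            (loopFamilyAction (d := 4) 3 γ cpl) (loopSupp γ) = {μ} ∧
        perturbedLimitPoints (((3 : ℕ) : ℝ) * ((1 / 6 : ℝ) / 9))
            (periodisedFamily (loopFamilyAction (d := 4) 3 γ cpl) (loopSupp γ) hdep hg hm hb) = {μ} ∧
        IsMassiveState μ ∧ HasExponentialDecay (plaquetteCorrFn (fundamentalRep (Fin 3)) μ) ∧
        HasAreaLawWith μ (fun g => normalisedCharacter 3 (fundamentalRep (Fin 3) g)) C c := by
  have hgap : MassGapOnBallZdG 4 3 ((1 / 6 : ℝ) / 9) (57 / 1000) (57 / 500) R := by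
    have h := (su3_massGapOnBallZdG_pvStar_oneSixth R).mono (ε₀' := 57 / 1000) (ε₁' := 57 / 500)
      (by norm_num) (by norm_num) le_rfl
    norm_num at h ⊢; exact h
  have hA0 : AreaLawOnBall 3 4 ((1 / 6 : ℝ) / 3) (2 * (57 / 500)) (57 / 500) R (2 * R + 1) :=
    su3_areaLawOnBall_pv (n := 3) R (mv := 2 * R + 1) (by omega) (βW := 1 / 6) (ε := 57 / 500) (R := 1 / 9) (q := 506897 / 500000)
      (p := 100223 / 62500) (K := 37859 / 20000) (s₀ := 925821 / 1000000) (by norm_num) (by norm_num) (by norm_num) (by norm_num) (by norm_num)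
      (by norm_num) (by norm_num) (by norm_num) (by norm_num) (by norm_num) (by norm_num) (by norm_num) (by norm_num) (by norm_num)
  have hA : AreaLawOnBall 3 4 (((3 : ℕ) : ℝ) * ((1 / 6 : ℝ) / 9)) (57 / 1000) (57 / 500) R (2 * R + 1) := by
    have e : ((3 : ℕ) : ℝ) * ((1 / 6 : ℝ) / 9) = (1 / 6 : ℝ) / 3 := by push_cast; ring
    rw [e]
    exact hA0.anti (by norm_num) (by norm_num) le_rfl le_rfl
  have hgap' : MassGapOnBallZdG 4 3 ((1 / 6 : ℝ) / 9) (57 / 1000) (57 / 500) R := hgap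
  obtain ⟨C, c, hc, hA'⟩ := oneState_onBallZdG (N := 3) (β := (1 / 6 : ℝ) / 9) (by norm_num) (by norm_num) (by norm_num) hgap' hA
  refine ⟨C, c, hc, fun γ cpl hfin hthr hR h hdep hg hm hb => hA' _ _ ?_ hdep hg hm hb⟩
  have hmem := memBallZdG_loopFamilyAction (d := 4) (N := 3) hfin hthr hR h
  norm_num at hmem ⊢
  exact hmem

/-- **`SU(3)`, `ℤ⁴`, `β_W = 1 / 5`, loop norm `‖c‖₀ ≤ .0217`, HYPOTHESIS-FREE**: for each range `R` one `(C, c)`, `c > 0`, such that EVERY finite-range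
`SU(3)` loop action (finite carrier fibres, finitely many loops through every link, loops of extent `≤ R`, `LoopNormLE 0 γ cpl (87 / 4000)`) near Wilson
`β_W = 1 / 5` has ONE state: unique DLR state = periodised-torus limit, massive, plaquette decay, `HasAreaLawWith μ χ₃ C c`
(`su3_massGapOnBallZdG_pvStar_oneFifth` × the PV area law, loads shrunk to `(87 / 2000, 87 / 1000)`). [folklore] -/
theorem su3_loops_oneState_pv_oneFifth (R : ℕ) :
    ∃ C c : ℝ, 0 < c ∧ ∀ (γ : ι → ZdLoop 4) (cpl : ι → ℝ),
      (∀ X, {i | walkEdges (γ i).walk = X}.Finite) → (∀ e : ZdEdge 4, {i | e ∈ walkEdges (γ i).walk}.Finite) →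
      (∀ i, ∀ e ∈ walkEdges (γ i).walk, ∀ y ∈ walkEdges (γ i).walk, ‖e.1 - y.1‖ ≤ (R : ℝ)) →
      LoopNormLE 0 γ cpl (87 / 4000) →
      ∀ (hdep : ∀ X, DependsOn (loopFamilyAction (d := 4) 3 γ cpl X) (↑X : Set (ZdEdge 4)))
        (hg : ∀ X, IsZdGaugeInvariant (loopFamilyAction (d := 4) 3 γ cpl X))
        (hm : ∀ X, Measurable (loopFamilyAction (d := 4) 3 γ cpl X))
        (hb : ∀ X, ∃ C, ∀ U, |loopFamilyAction (d := 4) 3 γ cpl X U| ≤ C),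
      ∃ μ : Measure (LGConfig 4 (SUN 3)),
        perturbedGibbsMeasures (d := 4) (fundamentalRep (Fin 3)) (((3 : ℕ) : ℝ) * ((1 / 5 : ℝ) / 9))
            (loopFamilyAction (d := 4) 3 γ cpl) (loopSupp γ) = {μ} ∧
        perturbedLimitPoints (((3 : ℕ) : ℝ) * ((1 / 5 : ℝ) / 9))
            (periodisedFamily (loopFamilyAction (d := 4) 3 γ cpl) (loopSupp γ) hdep hg hm hb) = {μ} ∧
        IsMassiveState μ ∧ HasExponentialDecay (plaquetteCorrFn (fundamentalRep (Fin 3)) μ) ∧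
        HasAreaLawWith μ (fun g => normalisedCharacter 3 (fundamentalRep (Fin 3) g)) C c := by
  have hgap : MassGapOnBallZdG 4 3 ((1 / 5 : ℝ) / 9) (87 / 2000) (87 / 1000) R := by
    have h := (su3_massGapOnBallZdG_pvStar_oneFifth R).mono (ε₀' := 87 / 2000) (ε₁' := 87 / 1000)
      (by norm_num) (by norm_num) le_rfl
    norm_num at h ⊢; exact h
  have hA0 : AreaLawOnBall 3 4 ((1 / 5 : ℝ) / 3) (2 * (87 / 1000)) (87 / 1000) R (2 * R + 1) :=
    su3_areaLawOnBall_pv (n := 3) R (mv := 2 * R + 1) (by omega) (βW := 1 / 5) (ε := 87 / 1000) (R := 2 / 15) (q := 254951 / 250000)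
      (p := 825723 / 500000) (K := 40289 / 20000) (s₀ := 953463 / 1000000) (by norm_num) (by norm_num) (by norm_num) (by norm_num) (by norm_num)
      (by norm_num) (by norm_num) (by norm_num) (by norm_num) (by norm_num) (by norm_num) (by norm_num) (by norm_num) (by norm_num)
  have hA : AreaLawOnBall 3 4 (((3 : ℕ) : ℝ) * ((1 / 5 : ℝ) / 9)) (87 / 2000) (87 / 1000) R (2 * R + 1) := by
    have e : ((3 : ℕ) : ℝ) * ((1 / 5 : ℝ) / 9) = (1 / 5 : ℝ) / 3 := by push_cast; ring
    rw [e]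
    exact hA0.anti (by norm_num) (by norm_num) le_rfl le_rfl
  have hgap' : MassGapOnBallZdG 4 3 ((1 / 5 : ℝ) / 9) (87 / 2000) (87 / 1000) R := hgap
  obtain ⟨C, c, hc, hA'⟩ := oneState_onBallZdG (N := 3) (β := (1 / 5 : ℝ) / 9) (by norm_num) (by norm_num) (by norm_num) hgap' hA
  refine ⟨C, c, hc, fun γ cpl hfin hthr hR h hdep hg hm hb => hA' _ _ ?_ hdep hg hm hb⟩
  have hmem := memBallZdG_loopFamilyAction (d := 4) (N := 3) hfin hthr hR h
  norm_num at hmem ⊢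
  exact hmem

/-- **`SU(3)`, `ℤ⁴`, `β_W = 1 / 4`, loop norm `‖c‖₀ ≤ .0123`, HYPOTHESIS-FREE**: for each range `R` one `(C, c)`, `c > 0`, such that EVERY finite-range
`SU(3)` loop action (finite carrier fibres, finitely many loops through every link, loops of extent `≤ R`, `LoopNormLE 0 γ cpl (49 / 4000)`) near Wilson
`β_W = 1 / 4` has ONE state: unique DLR state = periodised-torus limit, massive, plaquette decay, `HasAreaLawWith μ χ₃ C c`
(`su3_massGapOnBallZdG_pvStar_oneQuarter` × the PV area law, loads shrunk to `(49 / 2000, 49 / 1000)`). [folklore] -/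
theorem su3_loops_oneState_pv_oneQuarter (R : ℕ) :
    ∃ C c : ℝ, 0 < c ∧ ∀ (γ : ι → ZdLoop 4) (cpl : ι → ℝ),
      (∀ X, {i | walkEdges (γ i).walk = X}.Finite) → (∀ e : ZdEdge 4, {i | e ∈ walkEdges (γ i).walk}.Finite) →
      (∀ i, ∀ e ∈ walkEdges (γ i).walk, ∀ y ∈ walkEdges (γ i).walk, ‖e.1 - y.1‖ ≤ (R : ℝ)) →
      LoopNormLE 0 γ cpl (49 / 4000) →
      ∀ (hdep : ∀ X, DependsOn (loopFamilyAction (d := 4) 3 γ cpl X) (↑X : Set (ZdEdge 4)))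
        (hg : ∀ X, IsZdGaugeInvariant (loopFamilyAction (d := 4) 3 γ cpl X))
        (hm : ∀ X, Measurable (loopFamilyAction (d := 4) 3 γ cpl X))
        (hb : ∀ X, ∃ C, ∀ U, |loopFamilyAction (d := 4) 3 γ cpl X U| ≤ C),
      ∃ μ : Measure (LGConfig 4 (SUN 3)),
        perturbedGibbsMeasures (d := 4) (fundamentalRep (Fin 3)) (((3 : ℕ) : ℝ) * ((1 / 4 : ℝ) / 9))
            (loopFamilyAction (d := 4) 3 γ cpl) (loopSupp γ) = {μ} ∧
        perturbedLimitPoints (((3 : ℕ) : ℝ) * ((1 / 4 : ℝ) / 9))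
            (periodisedFamily (loopFamilyAction (d := 4) 3 γ cpl) (loopSupp γ) hdep hg hm hb) = {μ} ∧
        IsMassiveState μ ∧ HasExponentialDecay (plaquetteCorrFn (fundamentalRep (Fin 3)) μ) ∧
        HasAreaLawWith μ (fun g => normalisedCharacter 3 (fundamentalRep (Fin 3) g)) C c := by
  have hgap : MassGapOnBallZdG 4 3 ((1 / 4 : ℝ) / 9) (49 / 2000) (49 / 1000) R := by
    have h := (su3_massGapOnBallZdG_pvStar_oneQuarter R).mono (ε₀' := 49 / 2000) (ε₁' := 49 / 1000)
      (by norm_num) (by norm_num) le_rfl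
    norm_num at h ⊢; exact h
  have hA0 : AreaLawOnBall 3 4 ((1 / 4 : ℝ) / 3) (2 * (49 / 1000)) (49 / 1000) R (2 * R + 1) :=
    su3_areaLawOnBall_pv (n := 3) R (mv := 2 * R + 1) (by omega) (βW := 1 / 4) (ε := 49 / 1000) (R := 1 / 6) (q := 1030777 / 1000000)
      (p := 1732051 / 1000000) (K := 110919 / 50000) (s₀ := 1) (by norm_num) (by norm_num) (by norm_num) (by norm_num) (by norm_num)
      (by norm_num) (by norm_num) (by norm_num) (by norm_num) (by norm_num) (by norm_num) (by norm_num) (by norm_num) (by norm_num)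
  have hA : AreaLawOnBall 3 4 (((3 : ℕ) : ℝ) * ((1 / 4 : ℝ) / 9)) (49 / 2000) (49 / 1000) R (2 * R + 1) := by
    have e : ((3 : ℕ) : ℝ) * ((1 / 4 : ℝ) / 9) = (1 / 4 : ℝ) / 3 := by push_cast; ring
    rw [e]
    exact hA0.anti (by norm_num) (by norm_num) le_rfl le_rfl
  have hgap' : MassGapOnBallZdG 4 3 ((1 / 4 : ℝ) / 9) (49 / 2000) (49 / 1000) R := hgap
  obtain ⟨C, c, hc, hA'⟩ := oneState_onBallZdG (N := 3) (β := (1 / 4 : ℝ) / 9) (by norm_num) (by norm_num) (by norm_num) hgap' hA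
  refine ⟨C, c, hc, fun γ cpl hfin hthr hR h hdep hg hm hb => hA' _ _ ?_ hdep hg hm hb⟩
  have hmem := memBallZdG_loopFamilyAction (d := 4) (N := 3) hfin hthr hR h
  norm_num at hmem ⊢
  exact hmem

/-- **`SU(3)`, `ℤ⁴`, `β_W = 27 / 100`, loop norm `‖c‖₀ ≤ .0085`, HYPOTHESIS-FREE**: for each range `R` one `(C, c)`, `c > 0`, such that EVERY finite-range
`SU(3)` loop action (finite carrier fibres, finitely many loops through every link, loops of extent `≤ R`, `LoopNormLE 0 γ cpl (17 / 2000)`) near Wilson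
`β_W = 27 / 100` has ONE state: unique DLR state = periodised-torus limit, massive, plaquette decay, `HasAreaLawWith μ χ₃ C c`
(`su3_massGapOnBallZdG_pvStar_twentySevenHundredths` × the PV area law, loads shrunk to `(17 / 1000, 17 / 500)`). [folklore] -/
theorem su3_loops_oneState_pv_twentySevenHundredths (R : ℕ) :
    ∃ C c : ℝ, 0 < c ∧ ∀ (γ : ι → ZdLoop 4) (cpl : ι → ℝ),
      (∀ X, {i | walkEdges (γ i).walk = X}.Finite) → (∀ e : ZdEdge 4, {i | e ∈ walkEdges (γ i).walk}.Finite) →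
      (∀ i, ∀ e ∈ walkEdges (γ i).walk, ∀ y ∈ walkEdges (γ i).walk, ‖e.1 - y.1‖ ≤ (R : ℝ)) →
      LoopNormLE 0 γ cpl (17 / 2000) →
      ∀ (hdep : ∀ X, DependsOn (loopFamilyAction (d := 4) 3 γ cpl X) (↑X : Set (ZdEdge 4)))
        (hg : ∀ X, IsZdGaugeInvariant (loopFamilyAction (d := 4) 3 γ cpl X))
        (hm : ∀ X, Measurable (loopFamilyAction (d := 4) 3 γ cpl X))
        (hb : ∀ X, ∃ C, ∀ U, |loopFamilyAction (d := 4) 3 γ cpl X U| ≤ C),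
      ∃ μ : Measure (LGConfig 4 (SUN 3)),
        perturbedGibbsMeasures (d := 4) (fundamentalRep (Fin 3)) (((3 : ℕ) : ℝ) * ((27 / 100 : ℝ) / 9))
            (loopFamilyAction (d := 4) 3 γ cpl) (loopSupp γ) = {μ} ∧
        perturbedLimitPoints (((3 : ℕ) : ℝ) * ((27 / 100 : ℝ) / 9))
            (periodisedFamily (loopFamilyAction (d := 4) 3 γ cpl) (loopSupp γ) hdep hg hm hb) = {μ} ∧
        IsMassiveState μ ∧ HasExponentialDecay (plaquetteCorrFn (fundamentalRep (Fin 3)) μ) ∧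
        HasAreaLawWith μ (fun g => normalisedCharacter 3 (fundamentalRep (Fin 3) g)) C c := by
  have hgap : MassGapOnBallZdG 4 3 ((27 / 100 : ℝ) / 9) (17 / 1000) (17 / 500) R := by
    have h := (su3_massGapOnBallZdG_pvStar_twentySevenHundredths R).mono (ε₀' := 17 / 1000) (ε₁' := 17 / 500)
      (by norm_num) (by norm_num) le_rfl
    norm_num at h ⊢; exact h
  have hA0 : AreaLawOnBall 3 4 ((27 / 100 : ℝ) / 3) (2 * (17 / 500)) (17 / 500) R (2 * R + 1) :=
    su3_areaLawOnBall_pv (n := 3) R (mv := 2 * R + 1) (by omega) (βW := 27 / 100) (ε := 17 / 500) (R := 9 / 50) (q := 1035809 / 1000000)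
      (p := 1767767 / 1000000) (K := 230837 / 100000) (s₀ := 1020621 / 1000000) (by norm_num) (by norm_num) (by norm_num) (by norm_num) (by norm_num)
      (by norm_num) (by norm_num) (by norm_num) (by norm_num) (by norm_num) (by norm_num) (by norm_num) (by norm_num) (by norm_num)
  have hA : AreaLawOnBall 3 4 (((3 : ℕ) : ℝ) * ((27 / 100 : ℝ) / 9)) (17 / 1000) (17 / 500) R (2 * R + 1) := by
    have e : ((3 : ℕ) : ℝ) * ((27 / 100 : ℝ) / 9) = (27 / 100 : ℝ) / 3 := by push_cast; ring
    rw [e]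
    exact hA0.anti (by norm_num) (by norm_num) le_rfl le_rfl
  have hgap' : MassGapOnBallZdG 4 3 ((27 / 100 : ℝ) / 9) (17 / 1000) (17 / 500) R := hgap
  obtain ⟨C, c, hc, hA'⟩ := oneState_onBallZdG (N := 3) (β := (27 / 100 : ℝ) / 9) (by norm_num) (by norm_num) (by norm_num) hgap' hA
  refine ⟨C, c, hc, fun γ cpl hfin hthr hR h hdep hg hm hb => hA' _ _ ?_ hdep hg hm hb⟩
  have hmem := memBallZdG_loopFamilyAction (d := 4) (N := 3) hfin hthr hR h
  norm_num at hmem ⊢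
  exact hmem

/-- **`SU(3)`, `ℤ⁴`, `β_W = 3 / 10`, loop norm `‖c‖₀ ≤ .0032`, HYPOTHESIS-FREE**: for each range `R` one `(C, c)`, `c > 0`, such that EVERY finite-range
`SU(3)` loop action (finite carrier fibres, finitely many loops through every link, loops of extent `≤ R`, `LoopNormLE 0 γ cpl (13 / 4000)`) near Wilson
`β_W = 3 / 10` has ONE state: unique DLR state = periodised-torus limit, massive, plaquette decay, `HasAreaLawWith μ χ₃ C c`
(`su3_massGapOnBallZdG_pvStar_threeTenths` × the PV area law, loads shrunk to `(13 / 2000, 13 / 1000)`). [folklore] -/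
theorem su3_loops_oneState_pv_threeTenths (R : ℕ) :
    ∃ C c : ℝ, 0 < c ∧ ∀ (γ : ι → ZdLoop 4) (cpl : ι → ℝ),
      (∀ X, {i | walkEdges (γ i).walk = X}.Finite) → (∀ e : ZdEdge 4, {i | e ∈ walkEdges (γ i).walk}.Finite) →
      (∀ i, ∀ e ∈ walkEdges (γ i).walk, ∀ y ∈ walkEdges (γ i).walk, ‖e.1 - y.1‖ ≤ (R : ℝ)) →
      LoopNormLE 0 γ cpl (13 / 4000) →
      ∀ (hdep : ∀ X, DependsOn (loopFamilyAction (d := 4) 3 γ cpl X) (↑X : Set (ZdEdge 4)))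
        (hg : ∀ X, IsZdGaugeInvariant (loopFamilyAction (d := 4) 3 γ cpl X))
        (hm : ∀ X, Measurable (loopFamilyAction (d := 4) 3 γ cpl X))
        (hb : ∀ X, ∃ C, ∀ U, |loopFamilyAction (d := 4) 3 γ cpl X U| ≤ C),
      ∃ μ : Measure (LGConfig 4 (SUN 3)),
        perturbedGibbsMeasures (d := 4) (fundamentalRep (Fin 3)) (((3 : ℕ) : ℝ) * ((3 / 10 : ℝ) / 9))
            (loopFamilyAction (d := 4) 3 γ cpl) (loopSupp γ) = {μ} ∧
        perturbedLimitPoints (((3 : ℕ) : ℝ) * ((3 / 10 : ℝ) / 9))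
            (periodisedFamily (loopFamilyAction (d := 4) 3 γ cpl) (loopSupp γ) hdep hg hm hb) = {μ} ∧
        IsMassiveState μ ∧ HasExponentialDecay (plaquetteCorrFn (fundamentalRep (Fin 3)) μ) ∧
        HasAreaLawWith μ (fun g => normalisedCharacter 3 (fundamentalRep (Fin 3) g)) C c := by
  have hgap : MassGapOnBallZdG 4 3 ((3 / 10 : ℝ) / 9) (13 / 2000) (13 / 1000) R := by
    have h := (su3_massGapOnBallZdG_pvStar_threeTenths R).mono (ε₀' := 13 / 2000) (ε₁' := 13 / 1000)
      (by norm_num) (by norm_num) le_rfl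
    norm_num at h ⊢; exact h
  have hA0 : AreaLawOnBall 3 4 ((3 / 10 : ℝ) / 3) (2 * (13 / 1000)) (13 / 1000) R (2 * R + 1) :=
    su3_areaLawOnBall_pv (n := 3) R (mv := 2 * R + 1) (by omega) (βW := 3 / 10) (ε := 13 / 1000) (R := 1 / 5) (q := 1044031 / 1000000)
      (p := 912871 / 500000) (K := 122693 / 50000) (s₀ := 1054093 / 1000000) (by norm_num) (by norm_num) (by norm_num) (by norm_num) (by norm_num)
      (by norm_num) (by norm_num) (by norm_num) (by norm_num) (by norm_num) (by norm_num) (by norm_num) (by norm_num) (by norm_num)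
  have hA : AreaLawOnBall 3 4 (((3 : ℕ) : ℝ) * ((3 / 10 : ℝ) / 9)) (13 / 2000) (13 / 1000) R (2 * R + 1) := by
    have e : ((3 : ℕ) : ℝ) * ((3 / 10 : ℝ) / 9) = (3 / 10 : ℝ) / 3 := by push_cast; ring
    rw [e]
    exact hA0.anti (by norm_num) (by norm_num) le_rfl le_rfl
  have hgap' : MassGapOnBallZdG 4 3 ((3 / 10 : ℝ) / 9) (13 / 2000) (13 / 1000) R := hgap
  obtain ⟨C, c, hc, hA'⟩ := oneState_onBallZdG (N := 3) (β := (3 / 10 : ℝ) / 9) (by norm_num) (by norm_num) (by norm_num) hgap' hA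
  refine ⟨C, c, hc, fun γ cpl hfin hthr hR h hdep hg hm hb => hA' _ _ ?_ hdep hg hm hb⟩
  have hmem := memBallZdG_loopFamilyAction (d := 4) (N := 3) hfin hthr hR h
  norm_num at hmem ⊢
  exact hmem

/-- **`SU(3)`, `ℤ⁴`, `β_W = 31 / 100`, loop norm `‖c‖₀ ≤ .0013`, HYPOTHESIS-FREE**: for each range `R` one `(C, c)`, `c > 0`, such that EVERY finite-range
`SU(3)` loop action (finite carrier fibres, finitely many loops through every link, loops of extent `≤ R`, `LoopNormLE 0 γ cpl (1 / 800)`) near Wilson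
`β_W = 31 / 100` has ONE state: unique DLR state = periodised-torus limit, massive, plaquette decay, `HasAreaLawWith μ χ₃ C c`
(`su3_massGapOnBallZdG_pvStar_thirtyOneHundredths` × the PV area law, loads shrunk to `(1 / 400, 1 / 200)`). [folklore] -/
theorem su3_loops_oneState_pv_thirtyOneHundredths (R : ℕ) :
    ∃ C c : ℝ, 0 < c ∧ ∀ (γ : ι → ZdLoop 4) (cpl : ι → ℝ),
      (∀ X, {i | walkEdges (γ i).walk = X}.Finite) → (∀ e : ZdEdge 4, {i | e ∈ walkEdges (γ i).walk}.Finite) →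
      (∀ i, ∀ e ∈ walkEdges (γ i).walk, ∀ y ∈ walkEdges (γ i).walk, ‖e.1 - y.1‖ ≤ (R : ℝ)) →
      LoopNormLE 0 γ cpl (1 / 800) →
      ∀ (hdep : ∀ X, DependsOn (loopFamilyAction (d := 4) 3 γ cpl X) (↑X : Set (ZdEdge 4)))
        (hg : ∀ X, IsZdGaugeInvariant (loopFamilyAction (d := 4) 3 γ cpl X))
        (hm : ∀ X, Measurable (loopFamilyAction (d := 4) 3 γ cpl X))
        (hb : ∀ X, ∃ C, ∀ U, |loopFamilyAction (d := 4) 3 γ cpl X U| ≤ C),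
      ∃ μ : Measure (LGConfig 4 (SUN 3)),
        perturbedGibbsMeasures (d := 4) (fundamentalRep (Fin 3)) (((3 : ℕ) : ℝ) * ((31 / 100 : ℝ) / 9))
            (loopFamilyAction (d := 4) 3 γ cpl) (loopSupp γ) = {μ} ∧
        perturbedLimitPoints (((3 : ℕ) : ℝ) * ((31 / 100 : ℝ) / 9))
            (periodisedFamily (loopFamilyAction (d := 4) 3 γ cpl) (loopSupp γ) hdep hg hm hb) = {μ} ∧
        IsMassiveState μ ∧ HasExponentialDecay (plaquetteCorrFn (fundamentalRep (Fin 3)) μ) ∧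
        HasAreaLawWith μ (fun g => normalisedCharacter 3 (fundamentalRep (Fin 3) g)) C c := by
  have hgap : MassGapOnBallZdG 4 3 ((31 / 100 : ℝ) / 9) (1 / 400) (1 / 200) R := by
    have h := (su3_massGapOnBallZdG_pvStar_thirtyOneHundredths R).mono (ε₀' := 1 / 400) (ε₁' := 1 / 200)
      (by norm_num) (by norm_num) le_rfl
    norm_num at h ⊢; exact h
  have hA0 : AreaLawOnBall 3 4 ((31 / 100 : ℝ) / 3) (2 * (1 / 200)) (1 / 200) R (2 * R + 1) :=
    su3_areaLawOnBall_pv (n := 3) R (mv := 2 * R + 1) (by omega) (βW := 31 / 100) (ε := 1 / 200) (R := 31 / 150) (q := 261737 / 250000)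
      (p := 1846373 / 1000000) (K := 15659 / 6250) (s₀ := 266501 / 250000) (by norm_num) (by norm_num) (by norm_num) (by norm_num) (by norm_num)
      (by norm_num) (by norm_num) (by norm_num) (by norm_num) (by norm_num) (by norm_num) (by norm_num) (by norm_num) (by norm_num)
  have hA : AreaLawOnBall 3 4 (((3 : ℕ) : ℝ) * ((31 / 100 : ℝ) / 9)) (1 / 400) (1 / 200) R (2 * R + 1) := by
    have e : ((3 : ℕ) : ℝ) * ((31 / 100 : ℝ) / 9) = (31 / 100 : ℝ) / 3 := by push_cast; ring
    rw [e]
    exact hA0.anti (by norm_num) (by norm_num) le_rfl le_rfl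
  have hgap' : MassGapOnBallZdG 4 3 ((31 / 100 : ℝ) / 9) (1 / 400) (1 / 200) R := hgap
  obtain ⟨C, c, hc, hA'⟩ := oneState_onBallZdG (N := 3) (β := (31 / 100 : ℝ) / 9) (by norm_num) (by norm_num) (by norm_num) hgap' hA
  refine ⟨C, c, hc, fun γ cpl hfin hthr hR h hdep hg hm hb => hA' _ _ ?_ hdep hg hm hb⟩
  have hmem := memBallZdG_loopFamilyAction (d := 4) (N := 3) hfin hthr hR h
  norm_num at hmem ⊢
  exact hmem

end Summit.Ventures.YMGap.RobustBall

end
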